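import Literature.Geometry.Manifold.FreeCircleBundle
import HarnessLib

/-!
# Invariant smooth maps descend to the orbit manifold of a free circle action

Sixth file of the package on free smooth circle actions (`FreeCircleAction.lean`,
`FreeCircleFlowBox.lean`, `FreeCircleQuotient.lean`, `FreeCircleQuotientProjection.lean`,
`FreeCircleBundle.lean`).  J. M. Lee, *Introduction to Smooth Manifolds*, 2nd ed., Thm. 4.30
(passing smoothly to the quotient along a smooth surjective submersion: "if `π : M → N` is a
surjective smooth submersion and `F : M → P` is a smooth map constant on the fibres of `π`, there
is a unique smooth `F̃ : N → P` with `F̃ ∘ π = F`") for the orbit map `π : N → N/S¹` of a free smooth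
circle action (a surjective smooth submersion by Thm. 21.10, the tree's
`contMDiff_circleQuotientMk` / `surjective_mfderiv_circleQuotientMk`).  This is the form in which
maps OUT of a cut piece / the base of the null fibration are shown to be smooth in the unfolding of
an origami manifold (Cannas da Silva–Guillemin–Pires, *Symplectic Origami*, Prop. 2.8: the centre
`B ↪ M₀`, the blow-down `Z × (-ε, ε) → μ⁻¹(0)/S¹`).

* `circleQuotientLift g hg` — the descent `N/S¹ → X` of an invariant map `g : N → X`
  (`circleQuotientLift_mk : lift (π n) = g n`), `continuous_circleQuotientLift`;
* `contMDiffAt_circleQuotientLift` — **smooth descent**: if `g` is invariant and `C^∞` at `n`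
  then its descent is `C^∞` at `π n` (near `π n` it is `g ∘ Ψ ∘ (chart, 1)` for the equivariant
  local trivialisation `Ψ` of `exists_local_trivialization_circleQuotientMk`, and `g` is `C^∞`
  along the whole orbit of `n` by invariance); `contMDiff_circleQuotientLift`;
* `mfderiv_circleQuotientLift_comp_mfderiv` — the chain rule `d(lift)_{π n} ∘ dπ_n = dg_n`, and
  `mfderiv_circleQuotientLift_apply` (its pointwise form), which together with the surjectivity of
  `dπ_n` determine `d(lift)`;
* `injective_circleQuotientLift_iff` — the descent is injective iff `g` separates orbits.

Everything here is proved; the only definition is the descent itself; no facts.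

## References

* J. M. Lee, *Introduction to Smooth Manifolds*, 2nd ed., Springer GTM 218 (2012), Thm. 4.30,
  Thm. 21.10. [LeeSmoothManifolds2013]
* A. Cannas da Silva, V. Guillemin, A. R. Pires, *Symplectic Origami*, IMRN 2011 =
  arXiv:0909.4065, Prop. 2.8. [CannasdasilvaGuilleminPires2010]
-/

noncomputable section

open Set Filter Function TopologicalSpace Topology
open scoped Manifold ContDiff Topology

namespace Literature.Geometry.Manifold

/-! ### The descent of an invariant map -/

section Lift

variable {N : Type*} [TopologicalSpace N] [MulAction Circle N] {X : Type*}

/-- **The descent to the orbit space** of a map `g : N → X` invariant under the circle action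
(Lee 2012, Thm. 4.30, set-theoretic part). [cite: LeeSmoothManifolds2013, Thm. 4.30] -/
def circleQuotientLift (g : N → X) (hg : ∀ (a : Circle) (n : N), g (a • n) = g n) :
    CircleQuotient N → X :=
  Quotient.lift g fun x y (h : MulAction.orbitRel Circle N x y) => by
    obtain ⟨a, rfl⟩ := h
    exact hg a y

omit [TopologicalSpace N] in
/-- The descent composed with the orbit map is the original map (definitional). [folklore] -/
@[simp]
theorem circleQuotientLift_mk (g : N → X) (hg : ∀ (a : Circle) (n : N), g (a • n) = g n) (n : N) :
    circleQuotientLift g hg (circleQuotientMk n) = g n :=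
  rfl

omit [TopologicalSpace N] in
/-- `lift ∘ π = g`. [folklore] -/
theorem circleQuotientLift_comp_mk (g : N → X) (hg : ∀ (a : Circle) (n : N), g (a • n) = g n) :
    circleQuotientLift g hg ∘ circleQuotientMk = g :=
  rfl

omit [TopologicalSpace N] in
/-- The range of the descent is the range of `g`. [folklore] -/
theorem range_circleQuotientLift (g : N → X) (hg : ∀ (a : Circle) (n : N), g (a • n) = g n) :
    range (circleQuotientLift g hg) = range g := by
  ext x
  constructor
  · rintro ⟨q, rfl⟩
    obtain ⟨n, rfl⟩ := circleQuotientMk_surjective q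
    exact ⟨n, rfl⟩
  · rintro ⟨n, rfl⟩
    exact ⟨circleQuotientMk n, rfl⟩

omit [TopologicalSpace N] in
/-- The image of `π '' S` under the descent is `g '' S`. [folklore] -/
theorem image_circleQuotientLift (g : N → X) (hg : ∀ (a : Circle) (n : N), g (a • n) = g n)
    (S : Set N) : circleQuotientLift g hg '' (circleQuotientMk '' S) = g '' S := by
  rw [image_image]
  rfl

omit [TopologicalSpace N] in
/-- **The descent is injective iff `g` separates orbits**: `g x = g y → π x = π y`. [folklore] -/
theorem injective_circleQuotientLift_iff (g : N → X) (hg : ∀ (a : Circle) (n : N), g (a • n) = g n) :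
    Injective (circleQuotientLift g hg) ↔
      ∀ x y : N, g x = g y → ∃ a : Circle, a • y = x := by
  constructor
  · intro h x y hxy
    exact circleQuotientMk_eq_iff.1 (h (a₁ := circleQuotientMk x) (a₂ := circleQuotientMk y) hxy)
  · intro h p q hpq
    obtain ⟨x, rfl⟩ := circleQuotientMk_surjective p
    obtain ⟨y, rfl⟩ := circleQuotientMk_surjective q
    exact circleQuotientMk_eq_iff.2 (h x y hpq)

variable [TopologicalSpace X]

/-- The descent of a continuous invariant map is continuous (universal property of the quotient
topology). [folklore] -/
theorem continuous_circleQuotientLift {g : N → X} (hg : ∀ (a : Circle) (n : N), g (a • n) = g n)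
    (hgc : Continuous g) : Continuous (circleQuotientLift g hg) :=
  continuous_quot_lift _ hgc

/-- Continuity of the descent at `π n` from continuity of `g` at every point of the orbit of `n`
is not needed below; we record the global `ContinuousOn` form: if `g` is continuous on an
invariant set `S` which is open, the descent is continuous on `π '' S`. [folklore] -/
theorem continuousOn_circleQuotientLift [ContinuousSMul Circle N] {g : N → X}
    (hg : ∀ (a : Circle) (n : N), g (a • n) = g n) {S : Set N} (hS : IsOpen S)
    (hgc : ContinuousOn g S) : ContinuousOn (circleQuotientLift g hg) (circleQuotientMk '' S) := by
  rintro _ ⟨n, hn, rfl⟩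
  have hq : IsQuotientMap (circleQuotientMk : N → CircleQuotient N) :=
    isOpenQuotientMap_circleQuotientMk.isQuotientMap
  -- continuity within the open set `π '' S` = continuity at the point, read upstairs on `S`
  have hopen : IsOpen (circleQuotientMk '' S) := isOpenMap_circleQuotientMk S hS
  refine ContinuousAt.continuousWithinAt ?_
  rw [ContinuousAt, circleQuotientLift_mk]
  have hgn : ContinuousAt g n := hgc.continuousAt (hS.mem_nhds hn)
  -- `lift ∘ π` is continuous at `n`; push the neighbourhood filter forward along the open map `π`
  intro U hU
  have h1 : g ⁻¹' U ∈ 𝓝 n := hgn hU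
  have h2 : circleQuotientMk '' (g ⁻¹' U) ∈ 𝓝 (circleQuotientMk n) :=
    isOpenMap_circleQuotientMk.image_mem_nhds h1
  refine Filter.mem_map.2 (Filter.mem_of_superset h2 ?_)
  rintro _ ⟨m, hm, rfl⟩
  exact hm

end Lift

/-! ### Smooth descent -/

section Smooth

variable {k : ℕ} {N : Type*} [TopologicalSpace N] [ChartedSpace (EuclideanSpace ℝ (Fin k)) N]
  [IsManifold (𝓡 k) ∞ N] [T2Space N] [MulAction Circle N]
  {F : Type*} [NormedAddCommGroup F] [NormedSpace ℝ F] [FiniteDimensional ℝ F]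
  {E' : Type*} [NormedAddCommGroup E'] [NormedSpace ℝ E'] {H' : Type*} [TopologicalSpace H']
  {I' : ModelWithCorners ℝ E' H'} {X : Type*} [TopologicalSpace X] [ChartedSpace H' X]

omit [IsManifold (𝓡 k) ∞ N] [T2Space N] in
/-- An invariant map which is `C^∞` at `n` is `C^∞` at every point `a • n` of the orbit:
`g = g ∘ (a⁻¹ • ·)`. [folklore] -/
theorem contMDiffAt_smul_of_invariant
    (hθ : ContMDiff ((𝓡 1).prod (𝓡 k)) (𝓡 k) ∞ (fun x : Circle × N => x.1 • x.2))
    {g : N → X} (hg : ∀ (a : Circle) (n : N), g (a • n) = g n) {n : N}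
    (hgs : ContMDiffAt (𝓡 k) I' ∞ g n) (a : Circle) : ContMDiffAt (𝓡 k) I' ∞ g (a • n) := by
  have hsm : ContMDiff (𝓡 k) (𝓡 k) ∞ (fun q : N => a⁻¹ • q) :=
    hθ.comp (contMDiff_const.prodMk contMDiff_id)
  have heq : g = g ∘ fun q : N => a⁻¹ • q := by
    funext q
    exact (hg a⁻¹ q).symm
  have hpt : (fun q : N => a⁻¹ • q) (a • n) = n := inv_smul_smul a n
  have hgs' : ContMDiffAt (𝓡 k) I' ∞ g ((fun q : N => a⁻¹ • q) (a • n)) := by rwa [hpt]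
  rw [heq]
  exact ContMDiffAt.comp (a • n) hgs' hsm.contMDiffAt

/-- **Smooth descent along the orbit map** (Lee 2012, Thm. 4.30, for the surjective smooth
submersion `π : N → N/S¹` of Thm. 21.10): an invariant map `g`, `C^∞` at `n`, descends to a map
`C^∞` at `π n`.  Near `π n` the descent is `q ↦ g (Ψ (φ q, 1))` for the slice chart `φ` at
`π n` and the equivariant local trivialisation `Ψ` over it
(`exists_local_trivialization_circleQuotientMk`: `π (Ψ (u, a)) = φ⁻¹ u`).
[cite: LeeSmoothManifolds2013, Thm. 4.30] -/
theorem contMDiffAt_circleQuotientLift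
    (hθ : ContMDiff ((𝓡 1).prod (𝓡 k)) (𝓡 k) ∞ (fun x : Circle × N => x.1 • x.2))
    (hfree : ∀ (a : Circle) (x : N), a • x = x → a = 1)
    (hF : Module.finrank ℝ F + 1 = k)
    {g : N → X} (hg : ∀ (a : Circle) (n : N), g (a • n) = g n) {n : N}
    (hgs : ContMDiffAt (𝓡 k) I' ∞ g n) :
    letI := circleQuotientChartedSpace F hθ hfree hF
    ContMDiffAt 𝓘(ℝ, F) I' ∞ (circleQuotientLift g hg) (circleQuotientMk n) := by
  letI := circleQuotientChartedSpace F hθ hfree hF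
  haveI : ContinuousSMul Circle N := ⟨hθ.continuous⟩
  haveI := isManifold_circleQuotient (F := F) hθ hfree hF
  set q₀ : CircleQuotient N := circleQuotientMk n with hq₀
  obtain ⟨Ψ, hΨs, hΨt, hΨsm, -, hΨπ, -⟩ :=
    exists_local_trivialization_circleQuotientMk (F := F) hθ hfree hF q₀
  set φ := chartAt F q₀ with hφ
  -- the local formula
  have hloc : ∀ q ∈ φ.source, circleQuotientLift g hg q = g (Ψ (φ q, 1)) := by
    intro q hq
    have hu : (φ q, (1 : Circle)) ∈ Ψ.source := by
      rw [hΨs]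
      exact ⟨φ.map_source hq, mem_univ _⟩
    have hπ : circleQuotientMk (Ψ (φ q, 1)) = q := by
      rw [hΨπ _ _ hu, φ.left_inv hq]
    conv_lhs => rw [← hπ]
    rfl
  -- smoothness of the local formula at `q₀`
  have hq₀s : q₀ ∈ φ.source := mem_chart_source F q₀
  have hu₀ : (φ q₀, (1 : Circle)) ∈ Ψ.source := by
    rw [hΨs]
    exact ⟨φ.map_source hq₀s, mem_univ _⟩
  have hφsm : ContMDiffAt 𝓘(ℝ, F) 𝓘(ℝ, F) ∞ φ q₀ :=
    contMDiffOn_chart.contMDiffAt (φ.open_source.mem_nhds (mem_chart_source F q₀))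
  have hsec : ContMDiffAt 𝓘(ℝ, F) (𝓘(ℝ, F).prod (𝓡 1)) ∞ (fun q => (φ q, (1 : Circle))) q₀ :=
    hφsm.prodMk contMDiffAt_const
  have hΨat : ContMDiffAt (𝓘(ℝ, F).prod (𝓡 1)) (𝓡 k) ∞ Ψ (φ q₀, 1) :=
    hΨsm.contMDiffAt (Ψ.open_source.mem_nhds hu₀)
  -- `g` is smooth at `Ψ (φ q₀, 1)`, a point of the orbit of `n`
  have horb : ∃ a : Circle, a • n = Ψ (φ q₀, 1) := by
    have hπ : circleQuotientMk (Ψ (φ q₀, 1)) = circleQuotientMk n := by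
      rw [hΨπ _ _ hu₀, hq₀, φ.left_inv hq₀s]
    exact circleQuotientMk_eq_iff.1 hπ
  obtain ⟨a, ha⟩ := horb
  have hgat : ContMDiffAt (𝓡 k) I' ∞ g (Ψ (φ q₀, 1)) := by
    rw [← ha]
    exact contMDiffAt_smul_of_invariant hθ hg hgs a
  have hcomp : ContMDiffAt 𝓘(ℝ, F) I' ∞ (fun q => g (Ψ (φ q, 1))) q₀ :=
    hgat.comp q₀ (hΨat.comp q₀ hsec)
  refine hcomp.congr_of_eventuallyEq ?_
  filter_upwards [φ.open_source.mem_nhds hq₀s] with q hq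
  exact hloc q hq

/-- **Smooth descent, global form**: an invariant `C^∞` map descends to a `C^∞` map of the orbit
manifold (Lee 2012, Thm. 4.30). [cite: LeeSmoothManifolds2013, Thm. 4.30] -/
theorem contMDiff_circleQuotientLift
    (hθ : ContMDiff ((𝓡 1).prod (𝓡 k)) (𝓡 k) ∞ (fun x : Circle × N => x.1 • x.2))
    (hfree : ∀ (a : Circle) (x : N), a • x = x → a = 1)
    (hF : Module.finrank ℝ F + 1 = k)
    {g : N → X} (hg : ∀ (a : Circle) (n : N), g (a • n) = g n)
    (hgs : ContMDiff (𝓡 k) I' ∞ g) :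
    letI := circleQuotientChartedSpace F hθ hfree hF
    ContMDiff 𝓘(ℝ, F) I' ∞ (circleQuotientLift g hg) := by
  letI := circleQuotientChartedSpace F hθ hfree hF
  intro q
  obtain ⟨n, rfl⟩ := circleQuotientMk_surjective q
  exact contMDiffAt_circleQuotientLift hθ hfree hF hg (hgs n)

/-- **Smooth descent on an invariant open set**: if `g` is invariant and `C^∞` on an open set `S`,
its descent is `C^∞` on the open set `π '' S`. [cite: LeeSmoothManifolds2013, Thm. 4.30] -/
theorem contMDiffOn_circleQuotientLift
    (hθ : ContMDiff ((𝓡 1).prod (𝓡 k)) (𝓡 k) ∞ (fun x : Circle × N => x.1 • x.2))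
    (hfree : ∀ (a : Circle) (x : N), a • x = x → a = 1)
    (hF : Module.finrank ℝ F + 1 = k)
    {g : N → X} (hg : ∀ (a : Circle) (n : N), g (a • n) = g n) {S : Set N} (hS : IsOpen S)
    (hgs : ContMDiffOn (𝓡 k) I' ∞ g S) :
    letI := circleQuotientChartedSpace F hθ hfree hF
    ContMDiffOn 𝓘(ℝ, F) I' ∞ (circleQuotientLift g hg) (circleQuotientMk '' S) := by
  letI := circleQuotientChartedSpace F hθ hfree hF
  rintro _ ⟨n, hn, rfl⟩
  exact (contMDiffAt_circleQuotientLift hθ hfree hF hg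
    (hgs.contMDiffAt (hS.mem_nhds hn))).contMDiffWithinAt

/-- **Chain rule for the descent**: `d(lift)_{π n} ∘ dπ_n = dg_n` for an invariant map `C^∞` at
`n`. [cite: LeeSmoothManifolds2013, Thm. 4.30] -/
theorem mfderiv_circleQuotientLift_comp_mfderiv [IsManifold I' ∞ X]
    (hθ : ContMDiff ((𝓡 1).prod (𝓡 k)) (𝓡 k) ∞ (fun x : Circle × N => x.1 • x.2))
    (hfree : ∀ (a : Circle) (x : N), a • x = x → a = 1)
    (hF : Module.finrank ℝ F + 1 = k)
    {g : N → X} (hg : ∀ (a : Circle) (n : N), g (a • n) = g n) {n : N}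
    (hgs : ContMDiffAt (𝓡 k) I' ∞ g n) :
    letI := circleQuotientChartedSpace F hθ hfree hF
    (mfderiv 𝓘(ℝ, F) I' (circleQuotientLift g hg) (circleQuotientMk n)).comp
        (mfderiv (𝓡 k) 𝓘(ℝ, F) (circleQuotientMk : N → CircleQuotient N) n) =
      mfderiv (𝓡 k) I' g n := by
  letI := circleQuotientChartedSpace F hθ hfree hF
  haveI := isManifold_circleQuotient (F := F) hθ hfree hF
  have hπ : MDifferentiableAt (𝓡 k) 𝓘(ℝ, F) (circleQuotientMk : N → CircleQuotient N) n :=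
    ((contMDiff_circleQuotientMk hθ hfree hF) n).mdifferentiableAt (by simp)
  have hl : MDifferentiableAt 𝓘(ℝ, F) I' (circleQuotientLift g hg) (circleQuotientMk n) :=
    (contMDiffAt_circleQuotientLift hθ hfree hF hg hgs).mdifferentiableAt (by simp)
  have h := mfderiv_comp n hl hπ
  rw [circleQuotientLift_comp_mk] at h
  exact h.symm

/-- Pointwise chain rule: `d(lift)_{π n} (dπ_n v) = dg_n v`. [cite: LeeSmoothManifolds2013, Thm. 4.30] -/
theorem mfderiv_circleQuotientLift_apply [IsManifold I' ∞ X]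
    (hθ : ContMDiff ((𝓡 1).prod (𝓡 k)) (𝓡 k) ∞ (fun x : Circle × N => x.1 • x.2))
    (hfree : ∀ (a : Circle) (x : N), a • x = x → a = 1)
    (hF : Module.finrank ℝ F + 1 = k)
    {g : N → X} (hg : ∀ (a : Circle) (n : N), g (a • n) = g n) {n : N}
    (hgs : ContMDiffAt (𝓡 k) I' ∞ g n) (v : TangentSpace (𝓡 k) n) :
    letI := circleQuotientChartedSpace F hθ hfree hF
    mfderiv 𝓘(ℝ, F) I' (circleQuotientLift g hg) (circleQuotientMk n)
        (mfderiv (𝓡 k) 𝓘(ℝ, F) (circleQuotientMk : N → CircleQuotient N) n v) =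
      mfderiv (𝓡 k) I' g n v := by
  letI := circleQuotientChartedSpace F hθ hfree hF
  have h := mfderiv_circleQuotientLift_comp_mfderiv hθ hfree hF hg hgs
  exact congrArg (fun L => L v) h

/-- **The differential of the descent is injective** at `π n` as soon as `ker dg_n` is contained
in the orbit line `ker dπ_n`: `d(lift) ∘ dπ = dg` with `dπ_n` onto. [folklore] -/
theorem injective_mfderiv_circleQuotientLift [IsManifold I' ∞ X]
    (hθ : ContMDiff ((𝓡 1).prod (𝓡 k)) (𝓡 k) ∞ (fun x : Circle × N => x.1 • x.2))
    (hfree : ∀ (a : Circle) (x : N), a • x = x → a = 1)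
    (hF : Module.finrank ℝ F + 1 = k)
    {g : N → X} (hg : ∀ (a : Circle) (n : N), g (a • n) = g n) {n : N}
    (hgs : ContMDiffAt (𝓡 k) I' ∞ g n)
    (hker : letI := circleQuotientChartedSpace F hθ hfree hF
      ∀ v : TangentSpace (𝓡 k) n, mfderiv (𝓡 k) I' g n v = 0 →
        mfderiv (𝓡 k) 𝓘(ℝ, F) (circleQuotientMk : N → CircleQuotient N) n v = 0) :
    letI := circleQuotientChartedSpace F hθ hfree hF
    Injective (mfderiv 𝓘(ℝ, F) I' (circleQuotientLift g hg) (circleQuotientMk n)) := by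
  letI := circleQuotientChartedSpace F hθ hfree hF
  intro u₁ u₂ h12
  obtain ⟨v₁, rfl⟩ := surjective_mfderiv_circleQuotientMk hθ hfree hF n u₁
  obtain ⟨v₂, rfl⟩ := surjective_mfderiv_circleQuotientMk hθ hfree hF n u₂
  rw [← sub_eq_zero, ← map_sub]
  apply hker
  rw [map_sub, sub_eq_zero, ← mfderiv_circleQuotientLift_apply hθ hfree hF hg hgs v₁,
    ← mfderiv_circleQuotientLift_apply hθ hfree hF hg hgs v₂]
  exact h12

end Smooth

end Literature.Geometry.Manifold

end
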